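import Literature.Geometry.Lorentzian.CauchyDevelopment
import Literature.Geometry.Lorentzian.HypersurfaceNaturality
import Literature.Geometry.Lorentzian.CurvatureNaturality
import Literature.Geometry.Lorentzian.LorentzianMetricProofs
import Literature.Geometry.Lorentzian.HypersurfaceRestriction
import Literature.Geometry.Manifold.SmoothEmbeddingCodRestrict
import HarnessLib

/-!
# Restriction of a (vacuum) Cauchy development to an open subset: common developments as subsets
# (Sbierski 2016, Def. 2.4; Choquet-Bruhat–Geroch 1969, p. 332)

In the existence proof of the maximal globally hyperbolic development (Sbierski, Ann. Henri
Poincaré 17 (2016) = arXiv:1309.7591, §2–3; Choquet-Bruhat–Geroch, Comm. Math. Phys. 14 (1969),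
proof of Thm. 3), common globally hyperbolic developments of two developments `M`, `M'` are
realised as **open subsets** `U ⊆ M`: Sbierski, Def. 2.4 — *"we say that a GHD
`(U ⊆ M, g|_U, ι)` is a common globally hyperbolic development of `M` and `M'` iff `M'` is an
extension of `(U, g|_U, ι)`"* — and Choquet-Bruhat–Geroch, p. 332 — *"an open subset `U` of `N`
and an isometry `ψ` of `U` onto a subset of `N'` such that `U` is a development of `S`"*. This
file constructs that object over the prelude structures of `CauchyDevelopment.lean`:

* `DataEmbedding.restrict 𝒮 U hU hι hν` — for an open connected `U ⊆ M` containing `ι(X)`, the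
  data embedding `(U, g|_U, τ|_U, ι, ν)` (induced metric and second fundamental form are those of
  `M`: the restricted metric is the pullback along the inclusion,
  `PseudoRiemannianMetric.restrict_eq_comap`, and the shape tensor is natural under this local
  isometry, `PseudoRiemannianMetric.secondFundamentalForm_comap` of `HypersurfaceNaturality`;
  O'Neill 1983, Ch. 3, pp. 90–91, Ch. 4, Lemma 4.4 ff.); `DataEmbedding.restrict_embedsInto` —
  it embeds into `𝒮` by the inclusion; `DataEmbedding.isRicciFlat_restrict` — `Ric(g|_U) = 0` if
  `Ric(g) = 0` (`ricci_comap_apply`, `CurvatureNaturality`);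
* `CauchyDevelopment.restrict` (extra hypothesis: `ι(X)` is a Cauchy hypersurface of
  `(U, g|_U, τ|_U)` — the defining condition of a GHD `U ⊆ M`), `VacuumCauchyDevelopment.restrict`
  and their `restrict_embedsInto`.

The hypothesis `hν` (the normal field `ν` of `𝒮` is differentiable along `ι` as a map `X → TM`)
is needed to invoke the naturality of the shape tensor; it holds for every genuine development
(the future unit normal of a smooth spacelike hypersurface is smooth) but is not a field of the
structure `DataEmbedding`, so it is displayed. Supporting lemmas: `embedOpens` (the
codomain-restricted embedding, a smooth embedding by `Manifold.IsSmoothEmbedding.opensCodRestrict`),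
`mfderiv_embedOpens_apply`, `mdifferentiableAt_totalSpace_opens_iff` (fields along maps into an
open submanifold), `secondFundamentalForm_congr_metric` / `ricci_congr_metric`.

Implementation note. The spacetime of the restriction is written as a structure literal (the
content of `Spacetime.restrict`, with the discharged facts `contMDiff_restrict_holds`), so that its
instance projections reduce definitionally to the open-submanifold instances of `↥U`; all helper
lemmas are phrased over `↥U`.

## References

* J. Sbierski, *On the existence of a maximal Cauchy development for the Einstein equations: a
  dezornification*, Ann. Henri Poincaré 17 (2016) 301–329 = arXiv:1309.7591, Def. 2.4 and §3.1
  (the MCGHD as the union of all CGHDs `U ⊆ M`).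
* Y. Choquet-Bruhat, R. Geroch, Comm. Math. Phys. 14 (1969) 329–335, proof of Thm. 3, p. 332.
* B. O'Neill, *Semi-Riemannian geometry with applications to relativity*, 1983, Ch. 3,
  pp. 90–91 (local isometries), Prop. 3.59; Ch. 4, Lemma 4.4 ff. (shape tensor).
* H. Ringström, *The Cauchy Problem in General Relativity*, EMS 2009, Def. 16.5.
-/

noncomputable section

open Bundle Set Function Filter TopologicalSpace Manifold
open scoped Manifold ContDiff Topology

namespace Literature.Geometry.Lorentzian

universe u

/-! ### Sections along maps into an open submanifold -/

section OpensTangent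

variable {E : Type*} [NormedAddCommGroup E] [NormedSpace ℝ E] {H : Type*} [TopologicalSpace H]
  {I : ModelWithCorners ℝ E H} {M : Type*} [TopologicalSpace M] [ChartedSpace H M]
  [IsManifold I ∞ M]
  {EX : Type*} [NormedAddCommGroup EX] [NormedSpace ℝ EX] {HX : Type*} [TopologicalSpace HX]
  {IX : ModelWithCorners ℝ EX HX} {X : Type*} [TopologicalSpace X] [ChartedSpace HX X]

omit [IsManifold I ∞ M] in
/-- A map into an open submanifold `U ⊆ M` is differentiable at a point iff its composite with
the inclusion is (charts of `U` are restricted charts of `M`; Mathlib's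
`ChartedSpace.liftPropWithinAt_subtypeVal_comp_iff` for the differentiability property).
[folklore] -/
theorem mdifferentiableAt_subtypeVal_comp_iff (U : Opens M) {b : X → U} {x₀ : X} :
    MDifferentiableAt IX I (Subtype.val ∘ b) x₀ ↔ MDifferentiableAt IX I b x₀ :=
  ChartedSpace.liftPropWithinAt_subtypeVal_comp_iff (P := DifferentiableWithinAtProp IX I) b univ x₀

/-- **A field along a map into an open submanifold is differentiable (as a map into `TU`) iff it
is as a map into `TM`**: the base maps are differentiable simultaneously
(`mdifferentiableAt_subtypeVal_comp_iff`) and the preferred trivializations of `TU` and `TM` have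
the same fibre coordinates (`trivializationAt_tangentSpace_opens_snd`). Lee 2013, Prop. 3.9
(`T_p U = T_p M`). [folklore] -/
theorem mdifferentiableAt_totalSpace_opens_iff (U : Opens M) {b : X → U}
    {s : Π x : X, TangentSpace I (b x)} {x₀ : X} :
    MDifferentiableAt IX I.tangent
        (fun x ↦ (TotalSpace.mk' E (b x) (s x) : TangentBundle I U)) x₀ ↔
      MDifferentiableAt IX I.tangent
        (fun x ↦ (TotalSpace.mk' E (b x : M) (s x) : TangentBundle I M)) x₀ := by
  rw [mdifferentiableAt_totalSpace, mdifferentiableAt_totalSpace,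
    ← mdifferentiableAt_subtypeVal_comp_iff U (b := b)]
  refine and_congr_right fun _ ↦ ?_
  have h : (fun x ↦ ((trivializationAt E (TangentSpace I) (b x₀))
      (TotalSpace.mk' E (b x) (s x) : TangentBundle I U)).2) =
      fun x ↦ ((trivializationAt E (TangentSpace I) (b x₀ : M))
        (TotalSpace.mk' E (b x : M) (s x) : TangentBundle I M)).2 :=
    funext fun x ↦ trivializationAt_tangentSpace_opens_snd (I := I) U (b x₀) (b x) (s x)
  rw [h]

end OpensTangent

/-! ### Metrics with equal values have equal derived objects -/

section Congr

variable {E : Type*} [NormedAddCommGroup E] [NormedSpace ℝ E] {H : Type*} [TopologicalSpace H]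
  {I : ModelWithCorners ℝ E H} {M : Type*} [TopologicalSpace M] [ChartedSpace H M]
  [IsManifold I ∞ M] {n : ℕ∞ω} [FiniteDimensional ℝ E] [CompleteSpace E] [Fact (1 ≤ n)]
  {E' : Type*} [NormedAddCommGroup E'] [NormedSpace ℝ E'] {H' : Type*} [TopologicalSpace H']
  {I' : ModelWithCorners ℝ E' H'} {N : Type*} [TopologicalSpace N] [ChartedSpace H' N]
  [FiniteDimensional ℝ E']

namespace PseudoRiemannianMetric

omit [CompleteSpace E] [Fact (1 ≤ n)] in
/-- Equal metrics have equal second fundamental forms (whatever the proofs of the standing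
Levi-Civita hypothesis). [folklore] -/
theorem secondFundamentalForm_congr_metric
    {g₁ g₂ : PseudoRiemannianMetric I n E (TangentSpace I : M → Type _)} (h : g₁ = g₂)
    (i₁ : g₁.HasLeviCivita) (i₂ : g₂.HasLeviCivita) (f : N → M) (ν : NormalField I f) (y : N) :
    g₁.secondFundamentalForm I' f ν y = g₂.secondFundamentalForm I' f ν y := by
  subst h; rfl

omit [FiniteDimensional ℝ E] [CompleteSpace E] [Fact (1 ≤ n)] in
/-- Equal metrics have equal Ricci tensors (whatever the proofs of the standing Levi-Civita
hypothesis). [folklore] -/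
theorem ricci_congr_metric {g₁ g₂ : PseudoRiemannianMetric I n E (TangentSpace I : M → Type _)}
    (h : g₁ = g₂) (i₁ : g₁.HasLeviCivita) (i₂ : g₂.HasLeviCivita) (x : M) :
    g₁.ricci x = g₂.ricci x := by
  subst h; rfl

end PseudoRiemannianMetric

end Congr

/-! ### The restriction of a metric to an open subset is its pullback along the inclusion -/

section RestrictComap

variable {d : ℕ} {M : Type u} [TopologicalSpace M] [ChartedSpace (EuclideanSpace ℝ (Fin d)) M]
  [IsManifold (𝓡 d) ∞ M]

omit [IsManifold (𝓡 d) ∞ M] in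
/-- The inclusion of an open submanifold has injective (identity) differential. [folklore] -/
theorem injective_mfderiv_subtypeVal (U : Opens M) (y : U) :
    Function.Injective (mfderiv (𝓡 d) (𝓡 d) (Subtype.val : U → M) y) := by
  rw [mfderiv_subtypeVal]
  exact fun _ _ h ↦ h

/-- **The metric restricted to an open subset is the pullback along the inclusion**
(`PseudoRiemannianMetric.restrict` versus `PseudoRiemannianMetric.comap` along `Subtype.val`,
whose differential is the identity). O'Neill 1983, Ch. 3, p. 57 and pp. 90–91. [folklore] -/
theorem PseudoRiemannianMetric.restrict_eq_comap
    (g : PseudoRiemannianMetric (𝓡 d) ∞ (EuclideanSpace ℝ (Fin d)) (TangentSpace (𝓡 d) : M → Type _))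
    (U : Opens M) :
    g.restrict PseudoRiemannianMetric.contMDiff_restrict_holds U =
      g.comap PseudoRiemannianMetric.contMDiff_pullbackBilin_holds (Subtype.val : U → M)
        contMDiff_subtype_val (injective_mfderiv_subtypeVal U) rfl := by
  refine PseudoRiemannianMetric.ext (funext fun y ↦ ?_)
  ext v w
  change g.val y.1 v w = g.val y.1 (mfderiv (𝓡 d) (𝓡 d) (Subtype.val : U → M) y v)
    (mfderiv (𝓡 d) (𝓡 d) (Subtype.val : U → M) y w)
  rw [mfderiv_subtypeVal]
  rfl

end RestrictComap

/-! ### Restriction of data embeddings and Cauchy developments to open subsets -/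

section Developments

variable {n : ℕ} {X : Type u} [TopologicalSpace X] [ChartedSpace (EuclideanSpace ℝ (Fin n)) X]
  [IsManifold (𝓡 n) ∞ X] [ConnectedSpace X] {D : InitialDataSet (𝓡 n) X}

namespace DataEmbedding

variable (𝒮 : DataEmbedding D)

/-- The codomain-restricted embedding `ι : X → U` of the data manifold into an open subset
`U ⊇ ι(X)` of the spacetime of a data embedding. [folklore] -/
def embedOpens (U : Opens 𝒮.carrier) (hι : ∀ x, 𝒮.embed x ∈ U) : X → U :=
  fun x ↦ ⟨𝒮.embed x, hι x⟩

/-- The codomain-restricted embedding followed by the inclusion is the embedding. [folklore] -/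
theorem subtypeVal_comp_embedOpens (U : Opens 𝒮.carrier) (hι : ∀ x, 𝒮.embed x ∈ U) :
    Subtype.val ∘ 𝒮.embedOpens U hι = 𝒮.embed := rfl

/-- The codomain-restricted embedding is a smooth embedding into the open submanifold
(`Manifold.IsSmoothEmbedding.opensCodRestrict`). Lee 2013, Ch. 5. [folklore] -/
theorem isSmoothEmbedding_embedOpens (U : Opens 𝒮.carrier) (hι : ∀ x, 𝒮.embed x ∈ U) :
    Manifold.IsSmoothEmbedding (𝓡 n) (𝓡 (n + 1)) ∞ (𝒮.embedOpens U hι) :=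
  𝒮.isSmoothEmbedding.opensCodRestrict U hι

/-- The codomain-restricted embedding is differentiable. [folklore] -/
theorem mdifferentiableAt_embedOpens (U : Opens 𝒮.carrier) (hι : ∀ x, 𝒮.embed x ∈ U) (x : X) :
    MDifferentiableAt (𝓡 n) (𝓡 (n + 1)) (𝒮.embedOpens U hι) x :=
  ((𝒮.isSmoothEmbedding_embedOpens U hι).contMDiff x).mdifferentiableAt (by simp)

/-- The differential of the codomain-restricted embedding is that of the embedding
(`d(Subtype.val) = id`). [folklore] -/
theorem mfderiv_embedOpens_apply (U : Opens 𝒮.carrier) (hι : ∀ x, 𝒮.embed x ∈ U) (x : X)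
    (v : TangentSpace (𝓡 n) x) :
    mfderiv (𝓡 n) (𝓡 (n + 1)) (𝒮.embedOpens U hι) x v = mfderiv (𝓡 n) (𝓡 (n + 1)) 𝒮.embed x v := by
  have h := mfderiv_comp x
    (hasMFDerivAt_subtypeVal (I' := 𝓡 (n + 1)) (W := U) (𝒮.embedOpens U hι x)).mdifferentiableAt
    (𝒮.mdifferentiableAt_embedOpens U hι x)
  rw [subtypeVal_comp_embedOpens] at h
  rw [DFunLike.congr_fun h v]
  change mfderiv (𝓡 n) (𝓡 (n + 1)) (𝒮.embedOpens U hι) x v =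
    mfderiv (𝓡 (n + 1)) (𝓡 (n + 1)) (Subtype.val : U → 𝒮.carrier) (𝒮.embedOpens U hι x)
      (mfderiv (𝓡 n) (𝓡 (n + 1)) (𝒮.embedOpens U hι) x v)
  rw [mfderiv_subtypeVal]
  rfl

/-- **Restriction of a data embedding to an open subset.** Let `𝒮 = (M, g, τ, ι, ν)` be a data
embedding of `D`, `U ⊆ M` an open connected subset containing `ι(X)`, and suppose the normal
field `ν` is differentiable along `ι` (as a map `X → TM`; true for the future unit normal of any
development, which is smooth). Then `(U, g|_U, τ|_U, ι, ν)` is a data embedding of `D`: the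
induced metric and the second fundamental form of `ι` in the open sub-spacetime `U`
(`Spacetime.restrict`, with the discharged restriction facts `contMDiff_restrict_holds`) are those
in `M` (`T_p U = T_p M`; locality of the Levi-Civita connection and of the shape tensor — the
restricted metric is the pullback along the inclusion, `PseudoRiemannianMetric.restrict_eq_comap`,
and `PseudoRiemannianMetric.secondFundamentalForm_comap`; O'Neill 1983, Ch. 3, pp. 90–91 and
Ch. 4, Lemma 4.4 ff.). This is the object "`(U ⊆ M, g|_U, ι)`" of Sbierski 2016, Def. 2.4 (a
common globally hyperbolic development realised as a subset) and the "open subset U of N … such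
that U is a development of S" of Choquet-Bruhat–Geroch 1969, p. 332.
[cite: Sbierski2016AHP, Def. 2.4] -/
def restrict (U : Opens 𝒮.carrier) (hU : IsConnected (U : Set 𝒮.carrier))
    (hι : ∀ x, 𝒮.embed x ∈ U)
    (hν : ∀ x, MDifferentiableAt (𝓡 n) (𝓡 (n + 1)).tangent
      (fun x ↦ (TotalSpace.mk' (EuclideanSpace ℝ (Fin (n + 1))) (𝒮.embed x) (𝒮.normal x) :
        TangentBundle (𝓡 (n + 1)) 𝒮.carrier)) x) :
    DataEmbedding D where
  toSpacetime :=
    -- the open sub-spacetime `(U, g|_U, τ|_U)`, written as a structure literal (this is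
    -- `Spacetime.restrict`, inlined so that the instance projections reduce definitionally)
    { carrier := U
      metric := 𝒮.metric.restrict PseudoRiemannianMetric.contMDiff_restrict_holds U
      timeOrientation := 𝒮.timeOrientation.restrict PseudoRiemannianMetric.contMDiff_restrict_holds
        𝒮.timeOrientation.contMDiff_restrict_holds U
      connectedSpace := isConnected_iff_connectedSpace.mp hU }
  embed := 𝒮.embedOpens U hι
  isSmoothEmbedding := 𝒮.isSmoothEmbedding_embedOpens U hι
  normal := fun x ↦ 𝒮.normal x
  isFutureUnitNormal := by
    refine ⟨⟨fun y v ↦ ?_, fun y ↦ ?_⟩, fun y ↦ ?_⟩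
    · change 𝒮.metric.val (𝒮.embed y) (𝒮.normal y)
        (mfderiv (𝓡 n) (𝓡 (n + 1)) (𝒮.embedOpens U hι) y v) = 0
      rw [mfderiv_embedOpens_apply]
      exact 𝒮.isFutureUnitNormal.1.1 y v
    · exact 𝒮.isFutureUnitNormal.1.2 y
    · exact 𝒮.isFutureUnitNormal.2 y
  induced_h := fun y ↦ by
    ext v w
    change 𝒮.metric.val (𝒮.embed y) (mfderiv (𝓡 n) (𝓡 (n + 1)) (𝒮.embedOpens U hι) y v)
      (mfderiv (𝓡 n) (𝓡 (n + 1)) (𝒮.embedOpens U hι) y w) = D.h.inner y v w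
    rw [mfderiv_embedOpens_apply, mfderiv_embedOpens_apply, ← 𝒮.induced_h y, pullbackBilin_apply]
  induced_k := by
    intro inst y
    haveI := 𝒮.metric.toPseudoRiemannianMetric.hasLeviCivita
    -- the restricted metric is the pullback along the inclusion `Subtype.val : U → M`
    set gc := 𝒮.metric.toPseudoRiemannianMetric.comap
      PseudoRiemannianMetric.contMDiff_pullbackBilin_holds (Subtype.val : U → 𝒮.carrier)
      contMDiff_subtype_val (injective_mfderiv_subtypeVal U) rfl with hgc_def
    haveI hgcLC : gc.HasLeviCivita := gc.hasLeviCivita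
    have hgc : (𝒮.metric.restrict PseudoRiemannianMetric.contMDiff_restrict_holds
        U).toPseudoRiemannianMetric = gc :=
      PseudoRiemannianMetric.restrict_eq_comap 𝒮.metric.toPseudoRiemannianMetric U
    have key : gc.secondFundamentalForm (𝓡 n) (𝒮.embedOpens U hι) (fun x ↦ 𝒮.normal x) y =
        𝒮.metric.toPseudoRiemannianMetric.secondFundamentalForm (𝓡 n)
          ((Subtype.val : U → 𝒮.carrier) ∘ 𝒮.embedOpens U hι)
          (fun x ↦ mfderiv (𝓡 (n + 1)) (𝓡 (n + 1)) (Subtype.val : U → 𝒮.carrier)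
            (𝒮.embedOpens U hι x) (𝒮.normal x)) y :=
      PseudoRiemannianMetric.secondFundamentalForm_comap
        𝒮.metric.toPseudoRiemannianMetric PseudoRiemannianMetric.contMDiff_pullbackBilin_holds
        (Φ := (Subtype.val : U → 𝒮.carrier)) contMDiff_subtype_val
        (injective_mfderiv_subtypeVal U) rfl (f := 𝒮.embedOpens U hι) (ν := fun x ↦ 𝒮.normal x)
        (y := y) BoundarylessManifold.isInteriorPoint
        ((mdifferentiableAt_totalSpace_opens_iff U).2 (hν y))
    have hnormal : (fun x ↦ mfderiv (𝓡 (n + 1)) (𝓡 (n + 1)) (Subtype.val : U → 𝒮.carrier)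
        (𝒮.embedOpens U hι x) (𝒮.normal x)) = 𝒮.normal := by
      funext x; rw [mfderiv_subtypeVal]; rfl
    change (𝒮.metric.restrict PseudoRiemannianMetric.contMDiff_restrict_holds
        U).toPseudoRiemannianMetric.secondFundamentalForm (𝓡 n) (𝒮.embedOpens U hι)
        (fun x ↦ 𝒮.normal x) y = D.kBilin y
    rw [PseudoRiemannianMetric.secondFundamentalForm_congr_metric hgc inst hgcLC, key, hnormal]
    exact 𝒮.induced_k y

/-- **The restriction embeds into the original data embedding**, by the inclusion `U ⊆ M`: a
smooth open embedding with identity differential, hence isometric (`(g|_U)_p = g_p`) and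
time-orientation preserving, commuting with the embeddings of `X`. Ringström 2009, Def. 16.5;
Sbierski 2016, Def. 2.4 ("`M'` is an extension of `(U, g|_U, ι)`" is then inherited by every
extension of `M`). [cite: Sbierski2016AHP, Def. 2.4] -/
theorem restrict_embedsInto (U : Opens 𝒮.carrier) (hU : IsConnected (U : Set 𝒮.carrier))
    (hι : ∀ x, 𝒮.embed x ∈ U)
    (hν : ∀ x, MDifferentiableAt (𝓡 n) (𝓡 (n + 1)).tangent
      (fun x ↦ (TotalSpace.mk' (EuclideanSpace ℝ (Fin (n + 1))) (𝒮.embed x) (𝒮.normal x) :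
        TangentBundle (𝓡 (n + 1)) 𝒮.carrier)) x) :
    (𝒮.restrict U hU hι hν).EmbedsInto 𝒮 := by
  refine ⟨Subtype.val, contMDiff_subtype_val, U.2.isOpenEmbedding_subtypeVal,
    ⟨contMDiff_subtype_val, fun y ↦ ?_⟩, fun y ↦ ?_, rfl⟩
  · ext v w
    change 𝒮.metric.val y.1 (mfderiv (𝓡 (n + 1)) (𝓡 (n + 1)) (Subtype.val : U → 𝒮.carrier) y v)
      (mfderiv (𝓡 (n + 1)) (𝓡 (n + 1)) (Subtype.val : U → 𝒮.carrier) y w) = 𝒮.metric.val y.1 v w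
    rw [mfderiv_subtypeVal]
    rfl
  · change 𝒮.timeOrientation.IsFutureDirected
      (mfderiv (𝓡 (n + 1)) (𝓡 (n + 1)) (Subtype.val : U → 𝒮.carrier) y
        (𝒮.timeOrientation.vectorField y.1))
    rw [mfderiv_subtypeVal]
    exact 𝒮.timeOrientation.isFutureDirected_vectorField y.1

/-- The restricted metric of a vacuum data embedding is vacuum: `Ric(g|_U) = Ric(g)|_U = 0`
(locality of the curvature: the restricted metric is the pullback along the inclusion,
`PseudoRiemannianMetric.ricci_comap_apply`). O'Neill 1983, Ch. 3, Prop. 3.59.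
[cite: ONeillSemiRiemannian1983, Ch. 3, Prop. 3.59] -/
theorem isRicciFlat_restrict (U : Opens 𝒮.carrier) (h : 𝒮.IsVacuum)
    [(𝒮.metric.restrict PseudoRiemannianMetric.contMDiff_restrict_holds
      U).toPseudoRiemannianMetric.HasLeviCivita] :
    (𝒮.metric.restrict PseudoRiemannianMetric.contMDiff_restrict_holds
      U).toPseudoRiemannianMetric.IsRicciFlat := by
  intro y
  haveI := 𝒮.metric.toPseudoRiemannianMetric.hasLeviCivita
  set gc := 𝒮.metric.toPseudoRiemannianMetric.comap
    PseudoRiemannianMetric.contMDiff_pullbackBilin_holds (Subtype.val : U → 𝒮.carrier)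
    contMDiff_subtype_val (injective_mfderiv_subtypeVal U) rfl with hgc_def
  haveI hgcLC : gc.HasLeviCivita := gc.hasLeviCivita
  have hgc : (𝒮.metric.restrict PseudoRiemannianMetric.contMDiff_restrict_holds
      U).toPseudoRiemannianMetric = gc :=
    PseudoRiemannianMetric.restrict_eq_comap 𝒮.metric.toPseudoRiemannianMetric U
  rw [PseudoRiemannianMetric.ricci_congr_metric hgc inferInstance hgcLC]
  refine LinearMap.ext fun Y₀ ↦ LinearMap.ext fun Z₀ ↦ ?_
  have key : gc.ricci y Y₀ Z₀ = 𝒮.metric.toPseudoRiemannianMetric.ricci y.1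
      (mfderiv (𝓡 (n + 1)) (𝓡 (n + 1)) (Subtype.val : U → 𝒮.carrier) y Y₀)
      (mfderiv (𝓡 (n + 1)) (𝓡 (n + 1)) (Subtype.val : U → 𝒮.carrier) y Z₀) :=
    PseudoRiemannianMetric.ricci_comap_apply 𝒮.metric.toPseudoRiemannianMetric
      PseudoRiemannianMetric.contMDiff_pullbackBilin_holds (Φ := (Subtype.val : U → 𝒮.carrier))
      contMDiff_subtype_val (injective_mfderiv_subtypeVal U) rfl y Y₀ Z₀
  rw [key, h y.1]
  rfl

end DataEmbedding

namespace CauchyDevelopment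

variable (𝒟 : CauchyDevelopment D)

/-- **Restriction of a Cauchy development to an open subset in which the data hypersurface is
still a Cauchy hypersurface** — a (common) globally hyperbolic development realised as a subset
(Sbierski 2016, Def. 2.4: "a GHD `(U ⊆ M, g|_U, ι)`"; Choquet-Bruhat–Geroch 1969, p. 332: "an
open subset U of N … such that U is a development of S"). Hypotheses: `U` open and connected,
`ι(X) ⊆ U`, the normal of `𝒟` differentiable along `ι`, and `ι(X)` a Cauchy hypersurface of
`(U, g|_U, τ|_U)`. [cite: Sbierski2016AHP, Def. 2.4] -/
def restrict (U : Opens 𝒟.carrier) (hU : IsConnected (U : Set 𝒟.carrier))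
    (hι : ∀ x, 𝒟.embed x ∈ U)
    (hν : ∀ x, MDifferentiableAt (𝓡 n) (𝓡 (n + 1)).tangent
      (fun x ↦ (TotalSpace.mk' (EuclideanSpace ℝ (Fin (n + 1))) (𝒟.embed x) (𝒟.normal x) :
        TangentBundle (𝓡 (n + 1)) 𝒟.carrier)) x)
    (hC : (𝒟.metric.restrict PseudoRiemannianMetric.contMDiff_restrict_holds U).IsCauchyHypersurface
      (𝒟.timeOrientation.restrict PseudoRiemannianMetric.contMDiff_restrict_holds
        𝒟.timeOrientation.contMDiff_restrict_holds U) (range (𝒟.embedOpens U hι))) :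
    CauchyDevelopment D where
  toDataEmbedding := 𝒟.toDataEmbedding.restrict U hU hι hν
  isCauchyHypersurface := hC

/-- The restricted Cauchy development embeds into the original one (by the inclusion).
[cite: Sbierski2016AHP, Def. 2.4] -/
theorem restrict_embedsInto (U : Opens 𝒟.carrier) (hU : IsConnected (U : Set 𝒟.carrier))
    (hι : ∀ x, 𝒟.embed x ∈ U)
    (hν : ∀ x, MDifferentiableAt (𝓡 n) (𝓡 (n + 1)).tangent
      (fun x ↦ (TotalSpace.mk' (EuclideanSpace ℝ (Fin (n + 1))) (𝒟.embed x) (𝒟.normal x) :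
        TangentBundle (𝓡 (n + 1)) 𝒟.carrier)) x)
    (hC : (𝒟.metric.restrict PseudoRiemannianMetric.contMDiff_restrict_holds U).IsCauchyHypersurface
      (𝒟.timeOrientation.restrict PseudoRiemannianMetric.contMDiff_restrict_holds
        𝒟.timeOrientation.contMDiff_restrict_holds U) (range (𝒟.embedOpens U hι))) :
    (𝒟.restrict U hU hι hν hC).EmbedsInto 𝒟 :=
  𝒟.toDataEmbedding.restrict_embedsInto U hU hι hν

end CauchyDevelopment

namespace VacuumCauchyDevelopment

variable (𝒟 : VacuumCauchyDevelopment D)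

/-- **Restriction of a vacuum Cauchy development** (Sbierski 2016, Def. 2.4: common globally
hyperbolic *vacuum* developments as subsets `U ⊆ M`): the restricted Cauchy development is again
vacuum, `Ric(g|_U) = 0` (`DataEmbedding.isRicciFlat_restrict`). [cite: Sbierski2016AHP, Def. 2.4] -/
def restrict (U : Opens 𝒟.carrier) (hU : IsConnected (U : Set 𝒟.carrier))
    (hι : ∀ x, 𝒟.embed x ∈ U)
    (hν : ∀ x, MDifferentiableAt (𝓡 n) (𝓡 (n + 1)).tangent
      (fun x ↦ (TotalSpace.mk' (EuclideanSpace ℝ (Fin (n + 1))) (𝒟.embed x) (𝒟.normal x) :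
        TangentBundle (𝓡 (n + 1)) 𝒟.carrier)) x)
    (hC : (𝒟.metric.restrict PseudoRiemannianMetric.contMDiff_restrict_holds U).IsCauchyHypersurface
      (𝒟.timeOrientation.restrict PseudoRiemannianMetric.contMDiff_restrict_holds
        𝒟.timeOrientation.contMDiff_restrict_holds U) (range (𝒟.embedOpens U hι))) :
    VacuumCauchyDevelopment D where
  toCauchyDevelopment := 𝒟.toCauchyDevelopment.restrict U hU hι hν hC
  isRicciFlat := by
    intro inst
    haveI : (𝒟.metric.restrict PseudoRiemannianMetric.contMDiff_restrict_holds
        U).toPseudoRiemannianMetric.HasLeviCivita := inst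
    exact 𝒟.toDataEmbedding.isRicciFlat_restrict U 𝒟.isVacuum

/-- The restricted vacuum Cauchy development embeds into the original one: every open connected
`U ⊇ ι(X)` of a vacuum Cauchy development in which `ι(X)` is a Cauchy hypersurface is a vacuum
Cauchy development of the same data extended by the original (Sbierski 2016, Def. 2.4; in the
existence proof these are the common globally hyperbolic developments of two GHDs).
[cite: Sbierski2016AHP, Def. 2.4] -/
theorem restrict_embedsInto (U : Opens 𝒟.carrier) (hU : IsConnected (U : Set 𝒟.carrier))
    (hι : ∀ x, 𝒟.embed x ∈ U)
    (hν : ∀ x, MDifferentiableAt (𝓡 n) (𝓡 (n + 1)).tangent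
      (fun x ↦ (TotalSpace.mk' (EuclideanSpace ℝ (Fin (n + 1))) (𝒟.embed x) (𝒟.normal x) :
        TangentBundle (𝓡 (n + 1)) 𝒟.carrier)) x)
    (hC : (𝒟.metric.restrict PseudoRiemannianMetric.contMDiff_restrict_holds U).IsCauchyHypersurface
      (𝒟.timeOrientation.restrict PseudoRiemannianMetric.contMDiff_restrict_holds
        𝒟.timeOrientation.contMDiff_restrict_holds U) (range (𝒟.embedOpens U hι))) :
    (𝒟.restrict U hU hι hν hC).toCauchyDevelopment.EmbedsInto 𝒟.toCauchyDevelopment :=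
  𝒟.toDataEmbedding.restrict_embedsInto U hU hι hν

end VacuumCauchyDevelopment

end Developments

end Literature.Geometry.Lorentzian

end
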